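import Summits.CriticalPhenomena.PercolationContinuityZ3.Theorems.PercNearOneGluingNoHeavyPcintBSMTail
import HarnessLib

/-!
# PCINT lane, PHASE 6 (block renewal with reach-two pieces), step 1: the symmetric five-point law

Cell `prim-pcint`, seat `prim-pcint-1` (gen 15); memo `run/shared/lean/prim/pcint/T-FIBRE-ROUTE.md` §PHASE 6.

PHASE 6 runs the block-renewal second moment of PHASE 5 (…PcintBSM*) with transverse pieces of REACH TWO
(coordinate-monotone paths with at most two steps per axis) whose endpoint law is, coordinate by coordinate, a general
symmetric five-point law `g₅ a₁ a₂` on `{-2,…,2}` (`a₁` at `±1`, `a₂` at `±2`).  This file is the one-dimensional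
input replacing the lazy three-point walk of …PcintBSMLazy: the `n`-fold convolution `BSMX.H a₁ a₂ n` (defined by
the one-step recursion), its elementary properties (nonnegative, at most one, even, supported on `|δ| ≤ 2n`), the
pair word sums `BSMX.Apair5 = H (2n)` (the transverse factor of the product formula, …PcintBSMXGreen), and the
DISPERSION BOUND **`BSMX.H_sq_le`**: `H a₁ a₂ n δ ² ≤ 1 / ((n+1) · 4 a₁)` for `0 < a₁`, `0 ≤ a₂`, `4a₁ + 2a₂ ≤ 1`.
Proof of the latter: `g₅` is the mixture `α · g₃ s' + (1-α) · (uniform on ±2)` with `α = 1 - 2a₂`, `s' = 4a₁/α`;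
smoothing `H m` by `j` lazy steps (`BSMX.HL j m`) satisfies `HL j (m+1) = α HL (j+1) m + a₂ (shifts of HL j m)`, whence
by induction `HL j m ≤ Σ_i C(m,i) αⁱ (1-α)^{m-i} F s' (j+i) 0` (the lazy return probabilities, …PcintBSMLazy), and
Cauchy–Schwarz with `F s' i 0 ² ≤ 1/((i+1) s')` and `Σ_i C(m,i) αⁱ(1-α)^{m-i}/(i+1) ≤ 1/((m+1)α)`.
-/

noncomputable section

namespace Summit.CriticalPhenomena.PercolationContinuityZ3.Theorems.Pcint.BSMX

open Finset BSM

/-! ### The five letters and the law -/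

/-- The value `c - 2 ∈ {-2,…,2}` of a letter `c : Fin 5`. -/
def val5 (c : Fin 5) : ℤ := (c : ℤ) - 2

/-- **The symmetric five-point law**: `a₂, a₁, 1 - 2a₁ - 2a₂, a₁, a₂` at the values `-2, -1, 0, 1, 2`. -/
def g₅ (a₁ a₂ : ℝ) (c : Fin 5) : ℝ :=
  if c = 2 then 1 - 2 * a₁ - 2 * a₂ else if c = 1 ∨ c = 3 then a₁ else a₂

/-- The values of the letters. -/
theorem val5_apply : val5 0 = -2 ∧ val5 1 = -1 ∧ val5 2 = 0 ∧ val5 3 = 1 ∧ val5 4 = 2 := by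
  refine ⟨?_, ?_, ?_, ?_, ?_⟩ <;> simp [val5]

/-- The values of the law. -/
theorem g₅_apply (a₁ a₂ : ℝ) : g₅ a₁ a₂ 0 = a₂ ∧ g₅ a₁ a₂ 1 = a₁ ∧ g₅ a₁ a₂ 2 = 1 - 2 * a₁ - 2 * a₂ ∧
    g₅ a₁ a₂ 3 = a₁ ∧ g₅ a₁ a₂ 4 = a₂ := by
  refine ⟨?_, ?_, ?_, ?_, ?_⟩ <;> simp [g₅]

/-- `g₅ ≥ 0` for admissible parameters. -/
theorem g₅_nonneg {a₁ a₂ : ℝ} (h1 : 0 ≤ a₁) (h2 : 0 ≤ a₂) (h : 2 * a₁ + 2 * a₂ ≤ 1) (c : Fin 5) : 0 ≤ g₅ a₁ a₂ c := by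
  unfold g₅; split_ifs <;> linarith

/-- `g₅` is a probability vector. -/
theorem sum_g₅ (a₁ a₂ : ℝ) : ∑ c : Fin 5, g₅ a₁ a₂ c = 1 := by
  simp [Fin.sum_univ_five, g₅]; ring

/-! ### The `n`-fold convolution -/

/-- **`H a₁ a₂ n δ`**: the `n`-fold convolution of `g₅ a₁ a₂` at `δ`, by the one-step recursion. -/
def H (a₁ a₂ : ℝ) : ℕ → ℤ → ℝ
  | 0, δ => if δ = 0 then 1 else 0
  | n + 1, δ => ∑ c : Fin 5, g₅ a₁ a₂ c * H a₁ a₂ n (δ - val5 c)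

/-- `H 0 = 𝟙[δ = 0]`. -/
theorem H_zero (a₁ a₂ : ℝ) (δ : ℤ) : H a₁ a₂ 0 δ = if δ = 0 then 1 else 0 := rfl

/-- **The recursion**: `H (n+1) δ = Σ_c g₅ c · H n (δ - val5 c)`. -/
theorem H_succ (a₁ a₂ : ℝ) (n : ℕ) (δ : ℤ) : H a₁ a₂ (n + 1) δ = ∑ c : Fin 5, g₅ a₁ a₂ c * H a₁ a₂ n (δ - val5 c) := rfl

/-- The recursion written out. -/
theorem H_succ_five (a₁ a₂ : ℝ) (n : ℕ) (δ : ℤ) : H a₁ a₂ (n + 1) δ =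
    a₂ * H a₁ a₂ n (δ + 2) + a₁ * H a₁ a₂ n (δ + 1) + (1 - 2 * a₁ - 2 * a₂) * H a₁ a₂ n δ +
      a₁ * H a₁ a₂ n (δ - 1) + a₂ * H a₁ a₂ n (δ - 2) := by
  rw [H_succ, Fin.sum_univ_five, (g₅_apply a₁ a₂).1, (g₅_apply a₁ a₂).2.1, (g₅_apply a₁ a₂).2.2.1,
    (g₅_apply a₁ a₂).2.2.2.1, (g₅_apply a₁ a₂).2.2.2.2, val5_apply.1, val5_apply.2.1, val5_apply.2.2.1,
    val5_apply.2.2.2.1, val5_apply.2.2.2.2, sub_neg_eq_add, sub_neg_eq_add, sub_zero]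

/-- The reflected form of the recursion (the law is symmetric). -/
theorem H_succ' (a₁ a₂ : ℝ) (n : ℕ) (δ : ℤ) : H a₁ a₂ (n + 1) δ = ∑ c : Fin 5, g₅ a₁ a₂ c * H a₁ a₂ n (δ + val5 c) := by
  rw [H_succ_five, Fin.sum_univ_five, (g₅_apply a₁ a₂).1, (g₅_apply a₁ a₂).2.1, (g₅_apply a₁ a₂).2.2.1,
    (g₅_apply a₁ a₂).2.2.2.1, (g₅_apply a₁ a₂).2.2.2.2, val5_apply.1, val5_apply.2.1, val5_apply.2.2.1,
    val5_apply.2.2.2.1, val5_apply.2.2.2.2, add_zero, ← sub_eq_add_neg, ← sub_eq_add_neg]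
  ring

/-- `H ≥ 0`. -/
theorem H_nonneg {a₁ a₂ : ℝ} (h1 : 0 ≤ a₁) (h2 : 0 ≤ a₂) (h : 2 * a₁ + 2 * a₂ ≤ 1) : ∀ (n : ℕ) (δ : ℤ), 0 ≤ H a₁ a₂ n δ
  | 0, δ => by rw [H_zero]; split_ifs <;> norm_num
  | n + 1, δ => by
    rw [H_succ]; exact sum_nonneg fun c _ => mul_nonneg (g₅_nonneg h1 h2 h c) (H_nonneg h1 h2 h n _)

/-- `H ≤ 1`. -/
theorem H_le_one {a₁ a₂ : ℝ} (h1 : 0 ≤ a₁) (h2 : 0 ≤ a₂) (h : 2 * a₁ + 2 * a₂ ≤ 1) : ∀ (n : ℕ) (δ : ℤ), H a₁ a₂ n δ ≤ 1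
  | 0, δ => by rw [H_zero]; split_ifs <;> norm_num
  | n + 1, δ => by
    rw [H_succ]
    calc ∑ c : Fin 5, g₅ a₁ a₂ c * H a₁ a₂ n (δ - val5 c) ≤ ∑ c : Fin 5, g₅ a₁ a₂ c * 1 :=
          sum_le_sum fun c _ => mul_le_mul_of_nonneg_left (H_le_one h1 h2 h n _) (g₅_nonneg h1 h2 h c)
      _ = 1 := by rw [← sum_mul, sum_g₅, one_mul]

/-- `H` is even. -/
theorem H_neg (a₁ a₂ : ℝ) : ∀ (n : ℕ) (δ : ℤ), H a₁ a₂ n (-δ) = H a₁ a₂ n δ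
  | 0, δ => by rw [H_zero, H_zero]; simp only [neg_eq_zero]
  | n + 1, δ => by
    rw [H_succ, H_succ']
    refine sum_congr rfl fun c _ => ?_
    rw [show -δ - val5 c = -(δ + val5 c) by ring, H_neg a₁ a₂ n]

/-- `H` only depends on `|δ|`. -/
theorem H_abs (a₁ a₂ : ℝ) (n : ℕ) (δ : ℤ) : H a₁ a₂ n |δ| = H a₁ a₂ n δ := by
  rcases le_or_gt 0 δ with h | h
  · rw [abs_of_nonneg h]
  · rw [abs_of_neg h, H_neg]

/-- The values of the letters are at most `2` in absolute value. -/
theorem abs_val5_le (c : Fin 5) : |val5 c| ≤ 2 := by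
  unfold val5; have := c.2; rw [abs_le]; constructor <;> omega

/-- `H n δ = 0` when `|δ| > 2n`. -/
theorem H_eq_zero_of_lt (a₁ a₂ : ℝ) : ∀ {n : ℕ} {δ : ℤ}, 2 * (n : ℤ) < |δ| → H a₁ a₂ n δ = 0
  | 0, δ, h => by
    rw [H_zero]
    have : δ ≠ 0 := by rintro rfl; simp at h
    rw [if_neg this]
  | n + 1, δ, h => by
    rw [H_succ]
    refine sum_eq_zero fun c _ => ?_
    have hc := abs_val5_le c
    have : 2 * (n : ℤ) < |δ - val5 c| := by
      have h1 := abs_sub_abs_le_abs_sub δ (val5 c)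
      push_cast at h
      linarith
    rw [H_eq_zero_of_lt a₁ a₂ this, mul_zero]

/-! ### Pair word sums -/

/-- Pairs of words: `Apair5 n δ = Σ_ζ Π_j g₅(ζ_j.1) g₅(ζ_j.2) 𝟙[Σ_j (val5 ζ_j.2 - val5 ζ_j.1) = δ]`. -/
def Apair5 (a₁ a₂ : ℝ) (n : ℕ) (δ : ℤ) : ℝ :=
  ∑ ζ : Fin n → Fin 5 × Fin 5, (∏ j, (g₅ a₁ a₂ (ζ j).1 * g₅ a₁ a₂ (ζ j).2)) *
    if ∑ j, (val5 (ζ j).2 - val5 (ζ j).1) = δ then 1 else 0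

/-- **`Apair5 n = H (2n)`** (the difference of two letters is the sum of two letters in law, by symmetry). -/
theorem Apair5_eq_H (a₁ a₂ : ℝ) : ∀ (n : ℕ) (δ : ℤ), Apair5 a₁ a₂ n δ = H a₁ a₂ (2 * n) δ
  | 0, δ => by
    rw [Apair5, Nat.mul_zero, H_zero, Fintype.sum_unique]
    simp [eq_comm]
  | n + 1, δ => by
    rw [Apair5, BSM.sum_cons, show 2 * (n + 1) = 2 * n + 1 + 1 by ring, H_succ]
    simp_rw [H_succ' a₁ a₂ (2 * n)]
    rw [Fintype.sum_prod_type, sum_comm]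
    refine sum_congr rfl fun c' _ => ?_
    rw [mul_sum]
    refine sum_congr rfl fun c _ => ?_
    rw [← Apair5_eq_H a₁ a₂ n, Apair5, mul_sum, mul_sum]
    refine sum_congr rfl fun ζ _ => ?_
    rw [Fin.prod_univ_succ, Fin.sum_univ_succ]
    simp only [Fin.cons_zero, Fin.cons_succ]
    have : (val5 c' - val5 c + ∑ j : Fin n, (val5 (ζ j).2 - val5 (ζ j).1) = δ) ↔
        (∑ j : Fin n, (val5 (ζ j).2 - val5 (ζ j).1) = δ - val5 c' + val5 c) := by
      constructor <;> intro h <;> linarith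
    simp only [this]
    ring

/-- `Apair5 ≥ 0`. -/
theorem Apair5_nonneg {a₁ a₂ : ℝ} (h1 : 0 ≤ a₁) (h2 : 0 ≤ a₂) (h : 2 * a₁ + 2 * a₂ ≤ 1) (n : ℕ) (δ : ℤ) :
    0 ≤ Apair5 a₁ a₂ n δ :=
  sum_nonneg fun _ _ => mul_nonneg (prod_nonneg fun _ _ => mul_nonneg (g₅_nonneg h1 h2 h _) (g₅_nonneg h1 h2 h _))
    (by split_ifs <;> norm_num)

/-! ### The lazy component and the smoothed convolutions -/

/-- The mixture weight of the lazy component: `α = 1 - 2a₂`. -/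
def αm (a₂ : ℝ) : ℝ := 1 - 2 * a₂

/-- The parameter of the lazy component: `s' = 4a₁ / (1 - 2a₂)`. -/
def sL (a₁ a₂ : ℝ) : ℝ := 4 * a₁ / (1 - 2 * a₂)

/-- **Admissible parameters**: `0 < a₁`, `0 ≤ a₂`, `4a₁ + 2a₂ ≤ 1`. -/
def Adm (a₁ a₂ : ℝ) : Prop := 0 < a₁ ∧ 0 ≤ a₂ ∧ 4 * a₁ + 2 * a₂ ≤ 1

namespace Adm

variable {a₁ a₂ : ℝ}

/-- `a₁ > 0`. -/
theorem pos (h : Adm a₁ a₂) : 0 < a₁ := h.1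

/-- `a₂ ≥ 0`. -/
theorem nonneg (h : Adm a₁ a₂) : 0 ≤ a₂ := h.2.1

/-- `4a₁ + 2a₂ ≤ 1`. -/
theorem le (h : Adm a₁ a₂) : 4 * a₁ + 2 * a₂ ≤ 1 := h.2.2

/-- `a₁ ≥ 0`. -/
theorem a₁_nonneg (h : Adm a₁ a₂) : 0 ≤ a₁ := h.pos.le

/-- `2a₁ + 2a₂ ≤ 1`. -/
theorem two_le (h : Adm a₁ a₂) : 2 * a₁ + 2 * a₂ ≤ 1 := by linarith [h.pos, h.le]

/-- `α > 0`. -/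
theorem α_pos (h : Adm a₁ a₂) : 0 < αm a₂ := by unfold αm; linarith [h.pos, h.le]

/-- `α ≤ 1`. -/
theorem α_le_one (h : Adm a₁ a₂) : αm a₂ ≤ 1 := by unfold αm; linarith [h.nonneg]

/-- `s' > 0`. -/
theorem sL_pos (h : Adm a₁ a₂) : 0 < sL a₁ a₂ := by
  have hα : 0 < 1 - 2 * a₂ := by linarith [h.pos, h.le]
  unfold sL; exact div_pos (by linarith [h.pos]) hα

/-- `s' ≤ 1`. -/
theorem sL_le_one (h : Adm a₁ a₂) : sL a₁ a₂ ≤ 1 := by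
  have hα : 0 < 1 - 2 * a₂ := by linarith [h.pos, h.le]
  unfold sL; rw [div_le_one hα]; linarith [h.le]

/-- `α · s' = 4 a₁`. -/
theorem α_mul_sL (h : Adm a₁ a₂) : αm a₂ * sL a₁ a₂ = 4 * a₁ := by
  have hα : (1 - 2 * a₂) ≠ 0 := by have := h.α_pos; unfold αm at this; exact this.ne'
  unfold sL αm; field_simp

/-- The lazy component reproduces the three middle letters: `α g₃ s' = (a₁, 1-2a₁-2a₂, a₁)`. -/
theorem α_mul_g₃ (h : Adm a₁ a₂) : αm a₂ * g₃ (sL a₁ a₂) 0 = a₁ ∧ αm a₂ * g₃ (sL a₁ a₂) 1 = 1 - 2 * a₁ - 2 * a₂ ∧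
    αm a₂ * g₃ (sL a₁ a₂) 2 = a₁ := by
  have hα : (1 - 2 * a₂) ≠ 0 := by have := h.α_pos; unfold αm at this; exact this.ne'
  rw [(g₃_apply _).1, (g₃_apply _).2.1, (g₃_apply _).2.2]
  unfold sL αm
  refine ⟨?_, ?_, ?_⟩
  · field_simp
  · field_simp
    ring
  · field_simp

end Adm

/-- **Lazy smoothing**: `HL j m = (g₃ s')^{*j} * H m` (apply `j` lazy steps to `H m`). -/
def HL (a₁ a₂ : ℝ) : ℕ → ℕ → ℤ → ℝ
  | 0, m, δ => H a₁ a₂ m δ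
  | j + 1, m, δ => ∑ c : Fin 3, g₃ (sL a₁ a₂) c * HL a₁ a₂ j m (δ - val c)

/-- `HL 0 m = H m`. -/
theorem HL_zero (a₁ a₂ : ℝ) (m : ℕ) (δ : ℤ) : HL a₁ a₂ 0 m δ = H a₁ a₂ m δ := rfl

/-- The smoothing step. -/
theorem HL_succ (a₁ a₂ : ℝ) (j m : ℕ) (δ : ℤ) :
    HL a₁ a₂ (j + 1) m δ = ∑ c : Fin 3, g₃ (sL a₁ a₂) c * HL a₁ a₂ j m (δ - val c) := rfl

/-- Smoothing the point mass gives the lazy walk: `HL j 0 δ = F s' j δ`. -/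
theorem HL_zero_right (a₁ a₂ : ℝ) : ∀ (j : ℕ) (δ : ℤ), HL a₁ a₂ j 0 δ = F (sL a₁ a₂) j δ
  | 0, δ => by rw [HL_zero, H_zero, F_zero]
  | j + 1, δ => by
    rw [HL_succ, F_succ_sum]
    exact sum_congr rfl fun c _ => by rw [HL_zero_right a₁ a₂ j]

/-- **The mixture form of the recursion**: `H (m+1) δ = α Σ_c g₃ s' c H m (δ - val c) + a₂ (H m (δ-2) + H m (δ+2))`. -/
theorem H_succ_mix {a₁ a₂ : ℝ} (h : Adm a₁ a₂) (m : ℕ) (δ : ℤ) : H a₁ a₂ (m + 1) δ =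
    αm a₂ * (∑ c : Fin 3, g₃ (sL a₁ a₂) c * H a₁ a₂ m (δ - val c)) + a₂ * (H a₁ a₂ m (δ - 2) + H a₁ a₂ m (δ + 2)) := by
  rw [H_succ_five, Fin.sum_univ_three, val_apply.1, val_apply.2.1, val_apply.2.2, sub_neg_eq_add, sub_zero, mul_add,
    mul_add, ← mul_assoc, ← mul_assoc, ← mul_assoc, h.α_mul_g₃.1, h.α_mul_g₃.2.1, h.α_mul_g₃.2.2]
  ring

/-- **Commuting the smoothing with the last step**:
`HL j (m+1) δ = α HL (j+1) m δ + a₂ (HL j m (δ-2) + HL j m (δ+2))`. -/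
theorem HL_succ_right {a₁ a₂ : ℝ} (h : Adm a₁ a₂) : ∀ (j m : ℕ) (δ : ℤ), HL a₁ a₂ j (m + 1) δ =
    αm a₂ * HL a₁ a₂ (j + 1) m δ + a₂ * (HL a₁ a₂ j m (δ - 2) + HL a₁ a₂ j m (δ + 2))
  | 0, m, δ => by rw [HL_zero, H_succ_mix h, HL_succ]; rfl
  | j + 1, m, δ => by
    rw [HL_succ, HL_succ a₁ a₂ (j + 1), HL_succ a₁ a₂ j m (δ - 2), HL_succ a₁ a₂ j m (δ + 2)]
    simp_rw [HL_succ_right h j m]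
    rw [mul_sum, mul_add, mul_sum, mul_sum, ← sum_add_distrib, ← sum_add_distrib]
    refine sum_congr rfl fun c _ => ?_
    rw [show δ - 2 - val c = δ - val c - 2 by ring, show δ + 2 - val c = δ - val c + 2 by ring]
    ring

/-! ### The binomial smoothing bound -/

/-- The binomial average `Bav m j = Σ_{i+l=m} C(m,i) αⁱ (1-α)ˡ · F s' (j+i) 0`. -/
def Bav (a₁ a₂ : ℝ) (m j : ℕ) : ℝ :=
  ∑ il ∈ antidiagonal m, (m.choose il.1 : ℝ) * αm a₂ ^ il.1 * (1 - αm a₂) ^ il.2 * F (sL a₁ a₂) (j + il.1) 0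

/-- **Pascal's rule for binomial averages**: for any sequence `f`,
`Σ_{i+l=m+1} C(m+1,i) xⁱ yˡ f i = x Σ_{i+l=m} C(m,i) xⁱ yˡ f (i+1) + y Σ_{i+l=m} C(m,i) xⁱ yˡ f i`. -/
theorem pascal_sum (x y : ℝ) (f : ℕ → ℝ) (m : ℕ) :
    ∑ il ∈ antidiagonal (m + 1), ((m + 1).choose il.1 : ℝ) * x ^ il.1 * y ^ il.2 * f il.1 =
      x * ∑ il ∈ antidiagonal m, (m.choose il.1 : ℝ) * x ^ il.1 * y ^ il.2 * f (il.1 + 1) +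
        y * ∑ il ∈ antidiagonal m, (m.choose il.1 : ℝ) * x ^ il.1 * y ^ il.2 * f il.1 := by
  -- peel `i = 0` and split `C(m+1, i+1) = C(m, i) + C(m, i+1)`
  have step1 : ∑ il ∈ antidiagonal (m + 1), ((m + 1).choose il.1 : ℝ) * x ^ il.1 * y ^ il.2 * f il.1 =
      (∑ il ∈ antidiagonal (m + 1), (m.choose il.1 : ℝ) * x ^ il.1 * y ^ il.2 * f il.1) +
        ∑ il ∈ antidiagonal m, (m.choose il.1 : ℝ) * x ^ (il.1 + 1) * y ^ il.2 * f (il.1 + 1) := by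
    rw [Finset.Nat.sum_antidiagonal_succ, Finset.Nat.sum_antidiagonal_succ]
    simp only [Nat.choose_zero_right, Nat.choose_succ_succ, Nat.cast_add, Nat.cast_one]
    rw [add_assoc, ← sum_add_distrib]
    congr 1
    refine sum_congr rfl fun il _ => ?_
    ring
  -- the first sum is `y Σ …` (the term `i = m+1` vanishes)
  have step2 : ∑ il ∈ antidiagonal (m + 1), (m.choose il.1 : ℝ) * x ^ il.1 * y ^ il.2 * f il.1 =
      y * ∑ il ∈ antidiagonal m, (m.choose il.1 : ℝ) * x ^ il.1 * y ^ il.2 * f il.1 := by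
    rw [Finset.Nat.sum_antidiagonal_succ']
    simp only [Nat.choose_succ_self, Nat.cast_zero, zero_mul, zero_add]
    rw [mul_sum]
    refine sum_congr rfl fun il _ => ?_
    rw [pow_succ]
    ring
  have step3 : ∑ il ∈ antidiagonal m, (m.choose il.1 : ℝ) * x ^ (il.1 + 1) * y ^ il.2 * f (il.1 + 1) =
      x * ∑ il ∈ antidiagonal m, (m.choose il.1 : ℝ) * x ^ il.1 * y ^ il.2 * f (il.1 + 1) := by
    rw [mul_sum]
    refine sum_congr rfl fun il _ => ?_
    rw [pow_succ]
    ring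
  rw [step1, step2, step3, add_comm]

/-- The binomial averages satisfy the smoothing recursion. -/
theorem Bav_succ (a₁ a₂ : ℝ) (m j : ℕ) :
    Bav a₁ a₂ (m + 1) j = αm a₂ * Bav a₁ a₂ m (j + 1) + (1 - αm a₂) * Bav a₁ a₂ m j := by
  unfold Bav
  rw [pascal_sum (αm a₂) (1 - αm a₂) (fun i => F (sL a₁ a₂) (j + i) 0) m]
  congr 2
  refine sum_congr rfl fun il _ => ?_
  rw [show j + 1 + il.1 = j + (il.1 + 1) by ring]

/-- **The smoothing bound**: `HL j m δ ≤ Bav m j`. -/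
theorem HL_le {a₁ a₂ : ℝ} (h : Adm a₁ a₂) : ∀ (m j : ℕ) (δ : ℤ), HL a₁ a₂ j m δ ≤ Bav a₁ a₂ m j
  | 0, j, δ => by
    rw [HL_zero_right]
    unfold Bav
    rw [Finset.Nat.antidiagonal_zero, sum_singleton]
    simp only [Nat.choose_self, Nat.cast_one, pow_zero, mul_one, one_mul, add_zero]
    exact F_le_F_zero h.sL_pos.le h.sL_le_one j δ
  | m + 1, j, δ => by
    rw [HL_succ_right h, Bav_succ]
    have e1 := HL_le h m (j + 1) δ
    have e2 := HL_le h m j (δ - 2)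
    have e3 := HL_le h m j (δ + 2)
    have hα := h.α_pos.le
    have ha₂ := h.nonneg
    have : 1 - αm a₂ = 2 * a₂ := by unfold αm; ring
    rw [this]
    nlinarith [mul_le_mul_of_nonneg_left e1 hα, mul_le_mul_of_nonneg_left e2 ha₂, mul_le_mul_of_nonneg_left e3 ha₂]

/-- **The dispersion of the binomial average**: `Bav n 0 ² ≤ 1 / ((n+1) · 4a₁)`. -/
theorem Bav_sq_le {a₁ a₂ : ℝ} (h : Adm a₁ a₂) (n : ℕ) : Bav a₁ a₂ n 0 ^ 2 ≤ 1 / (((n : ℝ) + 1) * (4 * a₁)) := by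
  have hα0 := h.α_pos
  have hα1 := h.α_le_one
  have ht : 0 ≤ 1 - αm a₂ := by linarith
  have hs0 := h.sL_pos
  have hs1 := h.sL_le_one
  set p : ℕ × ℕ → ℝ := fun il => (n.choose il.1 : ℝ) * αm a₂ ^ il.1 * (1 - αm a₂) ^ il.2 with hp
  have hp0 : ∀ il ∈ antidiagonal n, 0 ≤ p il := fun il _ =>
    mul_nonneg (mul_nonneg (by positivity) (pow_nonneg hα0.le _)) (pow_nonneg ht _)
  -- Cauchy–Schwarz: `(Σ p f)² ≤ (Σ p) (Σ p f²)`
  have hcs := sum_sq_le_sum_mul_sum_of_sq_le_mul (antidiagonal n) (r := fun il => p il * F (sL a₁ a₂) il.1 0)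
    (f := p) (g := fun il => p il * F (sL a₁ a₂) il.1 0 ^ 2) hp0 (fun il hil => mul_nonneg (hp0 il hil) (sq_nonneg _))
    (fun il _ => by ring_nf; rfl)
  have hB : Bav a₁ a₂ n 0 = ∑ il ∈ antidiagonal n, p il * F (sL a₁ a₂) il.1 0 := by
    unfold Bav; exact sum_congr rfl fun il _ => by rw [zero_add]
  rw [hB]
  refine hcs.trans ?_
  rw [show ∑ il ∈ antidiagonal n, p il = 1 from sum_binomial_weights (αm a₂) n, one_mul]
  calc ∑ il ∈ antidiagonal n, p il * F (sL a₁ a₂) il.1 0 ^ 2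
      ≤ ∑ il ∈ antidiagonal n, p il / ((il.1 : ℝ) + 1) * (1 / sL a₁ a₂) := by
        refine sum_le_sum fun il hil => ?_
        have hF := F_zero_sq_le hs0 hs1 il.1
        have : p il * F (sL a₁ a₂) il.1 0 ^ 2 ≤ p il * (1 / (((il.1 : ℝ) + 1) * sL a₁ a₂)) :=
          mul_le_mul_of_nonneg_left hF (hp0 il hil)
        refine this.trans (le_of_eq ?_)
        field_simp
    _ = (∑ il ∈ antidiagonal n, p il / ((il.1 : ℝ) + 1)) * (1 / sL a₁ a₂) := by rw [sum_mul]
    _ ≤ 1 / (((n : ℝ) + 1) * αm a₂) * (1 / sL a₁ a₂) :=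
        mul_le_mul_of_nonneg_right (sum_binomial_weights_div_le hα0 hα1 n) (by positivity)
    _ = 1 / (((n : ℝ) + 1) * (4 * a₁)) := by
        rw [← h.α_mul_sL]; field_simp

/-- **The dispersion bound**: `H a₁ a₂ n δ ² ≤ 1 / ((n+1) · 4a₁)`. -/
theorem H_sq_le {a₁ a₂ : ℝ} (h : Adm a₁ a₂) (n : ℕ) (δ : ℤ) : H a₁ a₂ n δ ^ 2 ≤ 1 / (((n : ℝ) + 1) * (4 * a₁)) := by
  have h0 := H_nonneg h.a₁_nonneg h.nonneg h.two_le n δ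
  have h1 : H a₁ a₂ n δ ≤ Bav a₁ a₂ n 0 := by rw [← HL_zero]; exact HL_le h n 0 δ
  calc H a₁ a₂ n δ ^ 2 ≤ Bav a₁ a₂ n 0 ^ 2 := pow_le_pow_left₀ h0 h1 2
    _ ≤ _ := Bav_sq_le h n

/-- The dispersion bound for the pair sums: `H (2i) δ ² ≤ 1 / ((2i+1) · 4a₁)`. -/
theorem H_two_mul_sq_le {a₁ a₂ : ℝ} (h : Adm a₁ a₂) (i : ℕ) (δ : ℤ) :
    H a₁ a₂ (2 * i) δ ^ 2 ≤ 1 / ((2 * (i : ℝ) + 1) * (4 * a₁)) := by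
  have := H_sq_le h (2 * i) δ; push_cast at this; exact this

end Summit.CriticalPhenomena.PercolationContinuityZ3.Theorems.Pcint.BSMX

end
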